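import Mathlib
import HarnessLib
import Summits.Ventures.LatticeQCDFlow.Exactness.KernelCouplingGaugeEquivariance
import Summits.Ventures.LatticeQCDFlow.Exactness.KernelCouplingJacobian

/-!
# Masks make the plaquette kernel layer a coupling layer: frozen staples, frozen context, one active link per active plaquette — the engine's triangularity condition, for every `L`

HONEST FRAMING: exact (Metropolis-corrected) sampling algorithms for lattice gauge theory;
figures of merit are autocorrelation/cost numbers at stated couplings and volumes; no
continuum-physics claim.

Venture `LatticeQCDFlow` (cell pub-lqcd), topic `Exactness`; FANOUT row 10 (`eng-equiv`, engine
`latflow.equiv`, module `equiv/masks.py`: "LINK mask … phase(x) = (Σ_ν shifts[ν]·x_ν) mod width;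
active sites: phase(x) == active_phase; active links: active sites × directions" — presets
`stripes` (Kanwar/Boyda: width 4, shift along one direction), `checker`, `gen-checker`
(width 4, all shifts 1) — and "the ACTIVE plaquette of an active link … must contain exactly
ONE active link … `validate()` checks the triangularity condition that makes the Jacobian a
product of per-link factors").  NEW WORK of the cell over `KernelCouplingGaugeEquivariance.lean`
(the layer as a plain function), row 31's `Theory2.coupleFun` / `coupleJac` (coupling layers:
active coordinates updated by maps reading FROZEN coordinates only) and
`KernelCouplingJacobian.hasJacobian_kernelCouplingLayer`; nothing is cited as a fact; no number;
no definition is introduced.  Printed counterparts, NAMED ONLY: Kanwar et al. 2020 (Fig. 1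
masking pattern), Abbott et al. arXiv:2305.02402 §4.1.2 / App. 8.

## Content (`G` any group; `d`, `L` any; mask `p`, plane choice `ν e` per link)

* **`plaquetteKernelLayer_eq_coupleFun`** — THE BRIDGE: if at every active link `e = (x, μ)` the
  three other links of its active plaquette, `(x+μ̂, ν e)`, `(x+ν̂e, μ)`, `(x, ν e)`, are FROZEN
  and the kernel reads frozen links only (`h V e = H e (V|frozen)`), then the plaquette kernel
  layer of `isGaugeEquivariant_plaquetteKernelLayer` IS `Theory2.coupleFun p ψ` for the explicit
  single-link maps `ψ ⟨e,_⟩ y u = H e y (u·S) (u·S)⁻¹ u`, `S = y(x+μ̂,ν) y(x+ν̂,μ)⁻¹ y(x,ν)⁻¹`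
  — so row 31's coupling-layer theorems (`hasJacobian_coupleFun`, `coupleEquiv`, the entropy
  budget) and `hasJacobian_kernelCouplingLayer` apply to it verbatim;
* the engine's masks meet the hypothesis, for EVERY lattice size: with a "phase" that is ANY
  additive map `φ : (Fin d → ZMod L) →+ A` and the direction mask
  `p e ↔ e.2 = μ ∧ φ e.1 = c` (one active direction `μ`, active sites `φ x = c`):
  `directionMask_shift_dir_frozen`, `directionMask_plane_frozen` (links in a direction `≠ μ`
  are frozen) and **`directionMask_shift_plane_frozen`** (the opposite link `(x+ν̂, μ)` of the
  plaquette is frozen as soon as `φ(ν̂) ≠ 0` — the stripes / generalized-checkerboard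
  condition "shift along `ν` not `≡ 0 mod width`"); `directionMask_existsUnique` (every link is
  active for exactly one (direction, phase) — the layer cycle covers each link once per sweep);
* `stripesPhase_single` — the engine's phase for `stripes` / `gen-checker` on `ZMod L` with
  `w ∣ L`, `φ x = Σ_ρ s_ρ · (x_ρ mod w)`, has `φ(ν̂) = s_ν`: nonzero shift weight along the
  plaquette's plane is exactly what is needed (`stripes`: `s = 𝟙_{ρ}`, plane `ρ`; `gen-checker`:
  all `s_ρ = 1`, any plane; width `4 ∣ L`).

NOT here: location couplings / alternate cycles (other `(p, ν)` choices — same bridge once their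
frozen-link facts are listed), passive-plaquette bookkeeping for the conditioner's context (a
choice of WHICH frozen links `H` reads, immaterial here), any number.
-/

namespace Summit.Ventures.LatticeQCDFlow.Exactness

open Literature.MathematicalPhysics.QuantumFieldTheory

variable {d L : ℕ}

/-! ## The bridge: frozen staples + frozen context ⟹ the layer is a `coupleFun` -/

section Bridge

variable {G : Type*} [Group G]

/-- **The plaquette kernel layer is a coupling layer.**  Hypotheses: at every active link
`e = (x, μ)` the links `(x+μ̂, ν e)`, `(x+ν̂ e, μ)`, `(x, ν e)` are frozen (`h1`–`h3`), and the
kernel is a function `H e` of the frozen links (`hH`).  Conclusion: the layer equals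
`Theory2.coupleFun p ψ` with `ψ ⟨e,_⟩ y u = H e y (u S) (u S)⁻¹ u`, the staple `S` read off the
frozen configuration `y`. -/
theorem plaquetteKernelLayer_eq_coupleFun (p : Edge d L → Prop) [DecidablePred p]
    (ν : Edge d L → Fin d) (h : GaugeConfig d L G → Edge d L → G → G)
    (H : (e : Edge d L) → ({f : Edge d L // ¬p f} → G) → G → G)
    (hH : ∀ (V : GaugeConfig d L G) (e : Edge d L), p e → h V e = H e (fun f => V f))
    (h1 : ∀ e, p e → ¬p (e.1.shift e.2, ν e)) (h2 : ∀ e, p e → ¬p (e.1.shift (ν e), e.2))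
    (h3 : ∀ e, p e → ¬p (e.1, ν e)) :
    (fun (V : GaugeConfig d L G) (e : Edge d L) =>
      if p e then h V e (plaquetteHolonomy V e.1 e.2 (ν e)) * (plaquetteHolonomy V e.1 e.2 (ν e))⁻¹ * V e
      else V e) =
    Theory2.coupleFun p (fun a y u =>
      H a.1 y (u * (y ⟨_, h1 a.1 a.2⟩ * (y ⟨_, h2 a.1 a.2⟩)⁻¹ * (y ⟨_, h3 a.1 a.2⟩)⁻¹)) *
        (u * (y ⟨_, h1 a.1 a.2⟩ * (y ⟨_, h2 a.1 a.2⟩)⁻¹ * (y ⟨_, h3 a.1 a.2⟩)⁻¹))⁻¹ * u) := by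
  funext V e
  by_cases he : p e
  · rw [if_pos he, Theory2.coupleFun_apply_of_pos _ _ he, hH V e he]
    have hP : V e * (V (e.1.shift e.2, ν e) * (V (e.1.shift (ν e), e.2))⁻¹ * (V (e.1, ν e))⁻¹) =
        plaquetteHolonomy V e.1 e.2 (ν e) := by
      rw [← link_mul_plaquetteStaple V e.1 e.2 (ν e)]
    rw [hP]
  · rw [if_neg he, Theory2.coupleFun_apply_of_neg _ _ he]

/-- **Hence the plaquette kernel layer is exact with the kernels' Jacobians at the loops**
(`hasJacobian_kernelCouplingLayer` through the bridge): compact group, Haar probability per link,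
kernels `H e y` exact with densities `j e y ≥ 0`, joint measurability as stated. -/
theorem hasJacobian_plaquetteKernelLayer [TopologicalSpace G] [IsTopologicalGroup G] [CompactSpace G]
    [MeasurableSpace G] [BorelSpace G] [NeZero L]
    (p : Edge d L → Prop) [DecidablePred p]
    (ν : Edge d L → Fin d) (h : GaugeConfig d L G → Edge d L → G → G)
    (H : (e : Edge d L) → ({f : Edge d L // ¬p f} → G) → G → G)
    (j : (e : Edge d L) → ({f : Edge d L // ¬p f} → G) → G → ℝ)
    (hH : ∀ (V : GaugeConfig d L G) (e : Edge d L), p e → h V e = H e (fun f => V f))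
    (h1 : ∀ e, p e → ¬p (e.1.shift e.2, ν e)) (h2 : ∀ e, p e → ¬p (e.1.shift (ν e), e.2))
    (h3 : ∀ e, p e → ¬p (e.1, ν e))
    (hψ : ∀ a : {e // p e}, Measurable fun q : G × ({f : Edge d L // ¬p f} → G) =>
      H a.1 q.2 (q.1 * (q.2 ⟨_, h1 a.1 a.2⟩ * (q.2 ⟨_, h2 a.1 a.2⟩)⁻¹ * (q.2 ⟨_, h3 a.1 a.2⟩)⁻¹)) *
        (q.1 * (q.2 ⟨_, h1 a.1 a.2⟩ * (q.2 ⟨_, h2 a.1 a.2⟩)⁻¹ * (q.2 ⟨_, h3 a.1 a.2⟩)⁻¹))⁻¹ * q.1)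
    (hj : ∀ a : {e // p e}, Measurable fun q : G × ({f : Edge d L // ¬p f} → G) =>
      j a.1 q.2 (q.1 * (q.2 ⟨_, h1 a.1 a.2⟩ * (q.2 ⟨_, h2 a.1 a.2⟩)⁻¹ * (q.2 ⟨_, h3 a.1 a.2⟩)⁻¹)))
    (hJ : ∀ (a : {e // p e}) y, HasJacobian (haarProbability G) (H a.1 y) fun g => ENNReal.ofReal (j a.1 y g))
    (hj0 : ∀ (a : {e // p e}) y g, 0 ≤ j a.1 y g) :
    HasJacobian (MeasureTheory.Measure.pi fun _ : Edge d L => haarProbability G)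
      (fun (V : GaugeConfig d L G) (e : Edge d L) =>
        if p e then h V e (plaquetteHolonomy V e.1 e.2 (ν e)) * (plaquetteHolonomy V e.1 e.2 (ν e))⁻¹ * V e
        else V e)
      fun V => ENNReal.ofReal (Theory2.coupleJac p (fun a y u =>
        j a.1 y (u * (y ⟨_, h1 a.1 a.2⟩ * (y ⟨_, h2 a.1 a.2⟩)⁻¹ * (y ⟨_, h3 a.1 a.2⟩)⁻¹))) V) := by
  rw [plaquetteKernelLayer_eq_coupleFun p ν h H hH h1 h2 h3]
  exact hasJacobian_kernelCouplingLayer p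
    (fun a y => y ⟨_, h1 a.1 a.2⟩ * (y ⟨_, h2 a.1 a.2⟩)⁻¹ * (y ⟨_, h3 a.1 a.2⟩)⁻¹)
    (fun a y => H a.1 y) (fun a y => j a.1 y) hψ hj hJ hj0

end Bridge

/-! ## The engine's direction masks meet the hypotheses, for every lattice size -/

section Masks

variable {A : Type*} [AddGroup A]

/-- Links in a direction other than the active one are frozen: the link `(x+μ̂, ν e)` of the
active plaquette (`ν e ≠ μ`). -/
theorem directionMask_shift_dir_frozen (φ : (Fin d → ZMod L) →+ A) (c : A) (μ : Fin d)
    (ν : Edge d L → Fin d) (hν : ∀ e, ν e ≠ e.2) (e : Edge d L) (he : e.2 = μ ∧ φ e.1 = c) :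
    ¬((e.1.shift e.2, ν e).2 = μ ∧ φ (e.1.shift e.2, ν e).1 = c) := by
  rintro ⟨h, -⟩
  exact hν e (h.trans he.1.symm)

/-- Links in a direction other than the active one are frozen: the link `(x, ν e)`. -/
theorem directionMask_plane_frozen (φ : (Fin d → ZMod L) →+ A) (c : A) (μ : Fin d)
    (ν : Edge d L → Fin d) (hν : ∀ e, ν e ≠ e.2) (e : Edge d L) (he : e.2 = μ ∧ φ e.1 = c) :
    ¬((e.1, ν e).2 = μ ∧ φ (e.1, ν e).1 = c) := by
  rintro ⟨h, -⟩
  exact hν e (h.trans he.1.symm)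

/-- **The opposite link of the active plaquette is frozen** — the triangularity condition of
`masks.validate()`: `(x+ν̂, μ)` is inactive whenever `x` is active, because the phase moves by
`φ(ν̂) ≠ 0` (stripes: rows `4` apart along `ν`; generalized checkerboard: every unit shift moves
the phase). -/
theorem directionMask_shift_plane_frozen (φ : (Fin d → ZMod L) →+ A) (c : A) (μ : Fin d)
    (ν : Edge d L → Fin d) (hφ : ∀ e, φ (Pi.single (ν e) 1) ≠ 0) (e : Edge d L)
    (he : e.2 = μ ∧ φ e.1 = c) :
    ¬((e.1.shift (ν e), e.2).2 = μ ∧ φ (e.1.shift (ν e), e.2).1 = c) := by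
  rintro ⟨-, h⟩
  apply hφ e
  have h' : φ (e.1 + Pi.single (ν e) 1) = c := h
  rw [map_add, he.2] at h'
  exact add_eq_left.mp h'

/-- **Every link is active for exactly one (direction, phase)**: the family of direction masks
indexed by `(μ, c) ∈ Fin d × A` partitions the links — a full cycle of layers visits each link
exactly once. -/
theorem directionMask_existsUnique (φ : (Fin d → ZMod L) →+ A) (e : Edge d L) :
    ∃! mc : Fin d × A, e.2 = mc.1 ∧ φ e.1 = mc.2 := by
  refine ⟨(e.2, φ e.1), ⟨rfl, rfl⟩, ?_⟩
  rintro ⟨μ, c⟩ ⟨h1, h2⟩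
  exact Prod.ext h1.symm h2.symm

/-- **The engine's phase**: on `ZMod L` with `w ∣ L`, `φ x = Σ_ρ s_ρ · (x_ρ mod w)` is an additive
map with `φ(ν̂) = s_ν` — so `directionMask_shift_plane_frozen` applies in the plane `ν` iff the
shift weight `s_ν` is nonzero in `ZMod w` (`stripes`: `s = 𝟙_{ρ}`, plane `ρ`, `w = 4`;
`gen-checker`: all `s_ρ = 1`, any plane). -/
theorem stripesPhase_single {w : ℕ} (hw : w ∣ L) (s : Fin d → ZMod w) (ν₀ : Fin d) :
    (∑ ρ : Fin d, (AddMonoidHom.mulLeft (s ρ)).comp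
        (((ZMod.castHom hw (ZMod w)).toAddMonoidHom).comp (Pi.evalAddMonoidHom (fun _ => ZMod L) ρ)))
      (Pi.single ν₀ 1) = s ν₀ := by
  rw [AddMonoidHom.finsetSum_apply, Finset.sum_eq_single ν₀]
  · simp [ZMod.cast_one hw]
  · intro ρ _ hρ
    simp [hρ]
  · intro h
    exact absurd (Finset.mem_univ ν₀) h

end Masks

end Summit.Ventures.LatticeQCDFlow.Exactness
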